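import Summits.QuantumFields.YangMills.Theorems.UnitScaleTiltProp7OneFormAgmonBilinear
import HarnessLib

/-!
# Route `UnitScaleTilt`, crux K1 «MinimiserStabilityRegPr» (stmt-QuantumFields-19200), EX rows `h137kπ` ∕ `h137kΔ` ∕ `hCk` — **K-STOREY BRICK (K2b-δ₃)-B (px12 g17, LOCATE-K137 529f36ee road
# (K2)), FILE B2 OF 2: THE BILINEAR CONJUGATION DEFECT OF `V = Δ_a − D†D` AT THE MEMBER, PIECE (L) AND THE EXPORT** — the letter `hVconj₂` of
# ✓∕⧗`Prop7OneFormConjugateResolvent.norm_conj_resolvent_sub_le` ((K2b-δ₃)-A): for TWO bond fields `X′`, `X″` and a positive site weight `w`,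
# `|re([⟪toL2(w·X′), Δ_a toL2(w⁻¹·X″)⟫ − Σ_μ⟪D(w·X′)_μ, D(w⁻¹·X″)_μ⟫] − [⟪toL2 X′, Δ_a toL2 X″⟫ − Σ_μ⟪DX′_μ, DX″_μ⟫])| ≤ θ₂·‖toL2 X′‖·‖toL2 X″‖`, assembled through A2a ✓`inner_laplaceA_eq₂`
# (the Kato pairings cancel) from FILE B1's (Q)∕(P) pieces ✓∕⧗`Prop7OneFormAgmonBilinear`, the (L) local pairings (§4 here, CRUDE `O(ε₀)` edition: the two local pairings are bounded separately by
# A2d ✓`norm_local_conj_le_of_regPr` + bilinear Schur on the radius-2 ball) and the bilinear slot letter (S) (hypothesis; `0` at `DeltaEtaSlot`).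

Cell `ym3-torus` (HUMAN RULING D-0037: SU(2) YM₃ on T³ is ladder rung R3 — NOT d = 4, NOT infinite volume, NOT a mass gap, NOT Clay).  Width seat `ym3-torus-px12` gen 17.  THEOREMS ONLY
(0 `def`, 0 `sorry`, default heartbeats); `--supports stmt-QuantumFields-19200 --as helper`, count-neutral.  HONEST LABEL: bilinear re-readings of px21 g14's A2 pieces with the SAME letters and
constants; the (L) piece is crude (`θ_L = 32√2ε₀·d6^d·(1 + (1+ρ)²)` is `O(ε₀)`, NOT `O(ρ)`: downstream `δ₃ = O(r) + O(ε₀)` and (K2)'s `R < m₀` costs one more `ε₀ ≤ α_K(L)` window); nothing of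
(3.46)∕(3.132), `h137kπ`, `h137kΔ`, `hCk`, EX or 19200 is proved here.

WHAT IS PROVED (ns `Summit.QuantumFields.YangMills.Theorems.Prop7OneFormAgmonBilinearExport`; member `F`, `h : n ≤ K`, weights `c₀ cB`, slot `Δx`, coupling `a`).
* §4 ★ `norm_inner_local_conj_le₂` (`‖⟪toL2(w·X′), toL2(η⁻²(Δ′₁−𝒦)(w⁻¹·X″))⟫‖ ≤ 32√2ε₀(1+ρ)²·d6^d·‖X′‖‖X″‖`), `norm_inner_local_le₂` (`w ≡ 1`).
* §5 `abs_re_sub_le_of_pieces` (complex bookkeeping), ★★★ `hVconj₂_of_letters` — THE LETTER with `θ₂ = a·(2√κ²C_Q + κ²) + √2·Ck·θc·(d(L^d)^{K−n}(2(1+1∕(μ′−ν)))³) + θ_S + 32√2ε₀·d6^d·(1 + (1+ρ)²)`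
  (`κ² = 216ρ_Q²(cB∕(c₀ℓ³))` — the SAME constant as A2c's diagonal `θ_V`), `hslot₂_DeltaEtaSlot` (`θ_S = 0`), ★★★ `hVconj₂_of_letters_DeltaEtaSlot`.
HYP-SAT (★★OWNER RULING №42): exactly A2c's hypotheses (inhabited as there: `hk` ⟸ h349 ✓`kernelRow349_allMembers_exists` under Lift, `hQ` ⟸ ✓`norm_Qk_le_of_regPr`, `hwfar`∕`hρQ`∕`hρ` ⟸ A2e for
`w = e^{φ}`); nothing eventual; no hypothesis restates the conclusion.

References: T. Bałaban, CMP **99** (1985) 389–434 [Balaban1985BackgroundPropagators] ((3.10)–(3.16) pp.392–393, (3.26) p.395, Thm 3.1 (3.46) p.398, (3.49) p.399, (3.132) p.422);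
CMP **102** (1985) 277–309 [Balaban1985Variational] ((134)–(136) p.298); S. Agmon, *Lectures on exponential decay* (Princeton 1982) Ch. 1 [Agmon1982].
-/

set_option autoImplicit false

noncomputable section

open scoped BigOperators Matrix.Norms.L2Operator InnerProductSpace ComplexConjugate

namespace Summit.QuantumFields.YangMills.Theorems.Prop7OneFormAgmonBilinearExport

open Literature.MathematicalPhysics.QuantumFieldTheory.Balaban1983to89
open Literature.MathematicalPhysics.QuantumFieldTheory.Balaban1983to89.T3ContinuumYM3Torus
open T3SectALandauChart (eta eta_pos bgUnits formComp)
open T3PrintedRegularMinimiser (RegPr)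
open T3PrintedRegularOrbits (sites_eq)
open T3LevelShift (bondShift)
open B9TorusCalculus (torusT)
open B9Eq310Hermitian (deltaPrimeOp)
open B11Eq135Weitzenbock (curvOp)
open B11Eq103H1Complex (SiteL2K BondL2K)
open B9Eq311L2Pairing (WL2)
open B5Eq118OneStroke (iterBlockOf)
open B3Taylor310LocalRemainder (tdist_comm)
open Summit.QuantumFields.YangMills.Theorems.Prop7SectET3Transport (periodsT3)
open Summit.QuantumFields.YangMills.Theorems.Prop7SectET3HilbertLetters (W₂ frobEquiv toL2 toL2S toL2B DL2 DstarL2 inner_toL2 inner_toL2B inner_frobEquiv_symm)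
open Summit.QuantumFields.YangMills.Theorems.Prop7SectET3WilsonHessian (DeltaEta DeltaEtaSlot)
open Summit.QuantumFields.YangMills.Theorems.Prop7SectET3GaugeProjector (RS)
open Summit.QuantumFields.YangMills.Theorems.Prop7SectET3CurvedPropagators (laplaceA Qk)
open Summit.QuantumFields.YangMills.Theorems.Prop7SymAvgTwSym (QTwS)
open Summit.QuantumFields.YangMills.Theorems.Prop7TransverseRowOfTubeRowRegPr (Qk_toL2)
open Summit.QuantumFields.YangMills.Theorems.Prop7RieszTauFrobNorm (norm_sq_frobEquiv_symm norm_le_norm_frobEquiv_symm norm_frobEquiv_symm_le)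
open Summit.QuantumFields.YangMills.Theorems.Prop7LaplaceAFlatLetters (norm_sq_toL2)
open Summit.QuantumFields.YangMills.Theorems.Prop7BlockDistanceWeights (tdist_coarse_comm)
open Summit.QuantumFields.YangMills.Theorems.Prop7OneFormAgmonLetters (inner_laplaceA_eq₂ sum_pbond_exp_neg_mul_tdist_le)
open Summit.QuantumFields.YangMills.Theorems.Prop7OneFormAgmonAveraging (Qk_toL2_smul_eq_ref sum_normSq_entries_QTwS_relComm_le inner_toL2B_smul_smul_inv)
open Summit.QuantumFields.YangMills.Theorems.Prop7OneFormAgmonLocal (norm_local_conj_le_of_regPr sum_pbond_ball_indicator_le)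
open Summit.QuantumFields.YangMills.Theorems.Prop7QkWeightConjugation (norm_eta_smul_toL2B_le)
open Summit.QuantumFields.YangMills.Theorems.Prop7OneFormAgmonBilinear (abs_sum_sum_mul_le_of_row_le norm_inner_Qk_conj_sub_le₂ norm_inner_conj_kernel_sub_le₂)

/-! ## §4 (L) The local pair, bilinear (crude: each pairing bounded on its own) -/

section L

variable (F : T3Family) {n K : ℕ} (c₀ : ℝ) [Fact (0 < c₀)] (U₀ : GaugeField (F.P K) 0 (Matrix.specialUnitaryGroup (Fin 2) ℂ))

/-- ★ **THE CONJUGATED LOCAL PAIRING BETWEEN TWO FIELDS**: at `RegPr F n K ε₀ U₀`, for a positive weight with both bond ratios `≤ ρ` and all bond fields `X′`, `X″`,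
`‖⟪toL2(w(b₋)·X′), toL2(η⁻²(Δ′₁ − 𝒦)(w(b₋)⁻¹·X″))⟫‖ ≤ 32√2·ε₀·(1+ρ)²·(d·6^d)·‖toL2 X′‖·‖toL2 X″‖` — A2d ✓`norm_local_conj_le_of_regPr` pointwise (the weights cancel up to `(1+ρ)²`)
and Schur (§1) on the symmetric radius-2 ball indicator (row sums ✓`sum_pbond_ball_indicator_le`). [cite: Balaban1985Variational, (134)–(136) p.298; Balaban1985BackgroundPropagators, (3.10) p.392, Thm 3.1 (3.46) p.398] -/
theorem norm_inner_local_conj_le₂ {ε₀ : ℝ} (hε₀ : 0 ≤ ε₀) (hreg : RegPr F n K ε₀ U₀)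
    (w : Site (F.P K) 0 → ℝ) (hw : ∀ x, 0 < w x) {ρ : ℝ}
    (hρ : ∀ b : PBond (F.P K) 0, |w b.tgt / w b.src - 1| ≤ ρ ∧ |w b.src / w b.tgt - 1| ≤ ρ)
    (X' X'' : PBond (F.P K) 0 → Matrix (Fin 2) (Fin 2) ℂ) :
    ‖⟪toL2 F K c₀ (fun b => w b.src • X' b), toL2 F K c₀ (fun b : PBond (F.P K) 0 => (eta F n K)⁻¹ • (eta F n K)⁻¹ •
        (deltaPrimeOp (torusT (F.P K) 0) (fun μ x => bgUnits F K U₀ ⟨x, μ⟩) 1 (formComp (fun b' : PBond (F.P K) 0 => (w b'.src)⁻¹ • X'' b')) b.dir b.src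
          - curvOp (torusT (F.P K) 0) (fun μ x => bgUnits F K U₀ ⟨x, μ⟩) (formComp (fun b' : PBond (F.P K) 0 => (w b'.src)⁻¹ • X'' b')) b.dir b.src))⟫_ℂ‖
      ≤ 32 * Real.sqrt 2 * ε₀ * (1 + ρ) ^ 2 * (((F.P K).d : ℝ) * (2 * 3) ^ (F.P K).d) * ‖toL2 F K c₀ X'‖ * ‖toL2 F K c₀ X''‖ := by
  classical
  have hc₀ : 0 < c₀ := Fact.out
  have hρ0 : 0 ≤ ρ := by
    obtain ⟨x⟩ := (inferInstance : Nonempty (Site (F.P K) 0))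
    exact (abs_nonneg _).trans (hρ ⟨x, 0⟩).1
  set Lc : PBond (F.P K) 0 → Matrix (Fin 2) (Fin 2) ℂ := fun b : PBond (F.P K) 0 => (eta F n K)⁻¹ • (eta F n K)⁻¹ •
        (deltaPrimeOp (torusT (F.P K) 0) (fun μ x => bgUnits F K U₀ ⟨x, μ⟩) 1 (formComp (fun b' : PBond (F.P K) 0 => (w b'.src)⁻¹ • X'' b')) b.dir b.src
          - curvOp (torusT (F.P K) 0) (fun μ x => bgUnits F K U₀ ⟨x, μ⟩) (formComp (fun b' : PBond (F.P K) 0 => (w b'.src)⁻¹ • X'' b')) b.dir b.src) with hLc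
  set f' : PBond (F.P K) 0 → ℝ := fun b => ‖(frobEquiv.symm (X' b) : W₂)‖ with hf'
  set f'' : PBond (F.P K) 0 → ℝ := fun b => ‖(frobEquiv.symm (X'' b) : W₂)‖ with hf''
  set Kf : PBond (F.P K) 0 → PBond (F.P K) 0 → ℝ := fun b b' => if Site.tdist b.src b'.src ≤ 2 then (1 : ℝ) else 0 with hKf
  set C : ℝ := 32 * ε₀ * (1 + ρ) ^ 2 with hC
  have hC0 : 0 ≤ C := by positivity
  -- pointwise (A2d §2), rewritten against the indicator kernel
  have hpt : ∀ b : PBond (F.P K) 0, ‖Lc b‖ ≤ C * ((w b.src)⁻¹ * ∑ b', Kf b b' * f'' b') := by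
    intro b
    have h2 := norm_local_conj_le_of_regPr F U₀ hreg w hw hρ X'' b
    have hsum : ∑ b' : PBond (F.P K) 0, (if Site.tdist b.src b'.src ≤ 2 then ‖(frobEquiv.symm (X'' b') : W₂)‖ else 0) = ∑ b', Kf b b' * f'' b' :=
      Finset.sum_congr rfl fun b' _ => by simp only [hKf, hf'', ite_mul, one_mul, zero_mul]
    rw [hsum] at h2
    calc ‖Lc b‖ ≤ 32 * ε₀ * ((1 + ρ) ^ 2 * (w b.src)⁻¹ * ∑ b', Kf b b' * f'' b') := h2
      _ = C * ((w b.src)⁻¹ * ∑ b', Kf b b' * f'' b') := by rw [hC]; ring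
  -- the pairing, entrywise
  have hterm : ∀ b : PBond (F.P K) 0, ‖Matrix.trace (((fun b => w b.src • X' b) b).conjTranspose * Lc b)‖ ≤ Real.sqrt 2 * C * ∑ b', Kf b b' * (f' b * f'' b') := by
    intro b
    rw [← inner_frobEquiv_symm]
    have hn1 : ‖(frobEquiv.symm (w b.src • X' b) : W₂)‖ = w b.src * f' b := by
      rw [← Complex.coe_smul, map_smul, norm_smul, Complex.norm_real, Real.norm_of_nonneg (hw _).le]
    have hn2 : ‖(frobEquiv.symm (Lc b) : W₂)‖ ≤ Real.sqrt 2 * (C * ((w b.src)⁻¹ * ∑ b', Kf b b' * f'' b')) :=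
      (norm_frobEquiv_symm_le _).trans (mul_le_mul_of_nonneg_left (hpt b) (Real.sqrt_nonneg _))
    have hS0 : 0 ≤ ∑ b', Kf b b' * f'' b' := Finset.sum_nonneg fun b' _ => by
      have : 0 ≤ Kf b b' := by simp only [hKf]; split_ifs <;> norm_num
      exact mul_nonneg this (norm_nonneg _)
    calc ‖⟪(frobEquiv.symm (w b.src • X' b) : W₂), frobEquiv.symm (Lc b)⟫_ℂ‖
        ≤ ‖(frobEquiv.symm (w b.src • X' b) : W₂)‖ * ‖(frobEquiv.symm (Lc b) : W₂)‖ := norm_inner_le_norm _ _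
      _ ≤ (w b.src * f' b) * (Real.sqrt 2 * (C * ((w b.src)⁻¹ * ∑ b', Kf b b' * f'' b'))) := by
          rw [hn1]; exact mul_le_mul_of_nonneg_left hn2 (mul_nonneg (hw _).le (norm_nonneg _))
      _ = Real.sqrt 2 * C * (w b.src * (w b.src)⁻¹) * (f' b * ∑ b', Kf b b' * f'' b') := by ring
      _ = Real.sqrt 2 * C * ∑ b', Kf b b' * (f' b * f'' b') := by
          rw [mul_inv_cancel₀ (hw _).ne', mul_one, Finset.mul_sum, Finset.mul_sum, Finset.mul_sum]
          exact Finset.sum_congr rfl fun b' _ => by ring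
  -- Schur on the ball indicator, bilinear
  have hrow : ∀ b : PBond (F.P K) 0, ∑ b', Kf b b' ≤ ((F.P K).d : ℝ) * (2 * 3) ^ (F.P K).d := fun b => by
    simp only [hKf]; exact sum_pbond_ball_indicator_le F b.src
  have hschur := abs_sum_sum_mul_le_of_row_le Kf (fun b b' => by simp only [hKf]; split_ifs <;> norm_num)
    (fun b b' => by simp only [hKf, tdist_comm b.src b'.src]) (by positivity) hrow f' f''
  have hnormX' : ‖toL2 F K c₀ X'‖ = Real.sqrt c₀ * Real.sqrt (∑ b, f' b ^ 2) := by
    have h2 : ‖toL2 F K c₀ X'‖ ^ 2 = c₀ * ∑ b, f' b ^ 2 := by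
      rw [norm_sq_toL2]; congr 1; exact Finset.sum_congr rfl fun b _ => (norm_sq_frobEquiv_symm (X' b)).symm
    rw [← Real.sqrt_mul hc₀.le, ← h2, Real.sqrt_sq (norm_nonneg _)]
  have hnormX'' : ‖toL2 F K c₀ X''‖ = Real.sqrt c₀ * Real.sqrt (∑ b, f'' b ^ 2) := by
    have h2 : ‖toL2 F K c₀ X''‖ ^ 2 = c₀ * ∑ b, f'' b ^ 2 := by
      rw [norm_sq_toL2]; congr 1; exact Finset.sum_congr rfl fun b _ => (norm_sq_frobEquiv_symm (X'' b)).symm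
    rw [← Real.sqrt_mul hc₀.le, ← h2, Real.sqrt_sq (norm_nonneg _)]
  -- assemble
  rw [inner_toL2]
  calc ‖(c₀ : ℂ) * ∑ b : PBond (F.P K) 0, Matrix.trace (((fun b => w b.src • X' b) b).conjTranspose * Lc b)‖
      ≤ c₀ * ∑ b : PBond (F.P K) 0, Real.sqrt 2 * C * ∑ b', Kf b b' * (f' b * f'' b') := by
        rw [norm_mul, Complex.norm_real, Real.norm_of_nonneg hc₀.le]
        exact mul_le_mul_of_nonneg_left ((norm_sum_le _ _).trans (Finset.sum_le_sum fun b _ => hterm b)) hc₀.le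
    _ = Real.sqrt 2 * C * (c₀ * ∑ b, ∑ b', Kf b b' * (f' b * f'' b')) := by rw [← Finset.mul_sum]; ring
    _ ≤ Real.sqrt 2 * C * (c₀ * ((((F.P K).d : ℝ) * (2 * 3) ^ (F.P K).d) * Real.sqrt (∑ b, f' b ^ 2) * Real.sqrt (∑ b, f'' b ^ 2))) :=
        mul_le_mul_of_nonneg_left (mul_le_mul_of_nonneg_left ((le_abs_self _).trans hschur) hc₀.le) (by positivity)
    _ = 32 * Real.sqrt 2 * ε₀ * (1 + ρ) ^ 2 * (((F.P K).d : ℝ) * (2 * 3) ^ (F.P K).d) * ‖toL2 F K c₀ X'‖ * ‖toL2 F K c₀ X''‖ := by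
        rw [hnormX', hnormX'', hC]
        have e : Real.sqrt c₀ * Real.sqrt c₀ = c₀ := Real.mul_self_sqrt hc₀.le
        calc _ = Real.sqrt 2 * (32 * ε₀ * (1 + ρ) ^ 2) * (((F.P K).d : ℝ) * (2 * 3) ^ (F.P K).d)
              * ((Real.sqrt c₀ * Real.sqrt c₀) * (Real.sqrt (∑ b, f' b ^ 2) * Real.sqrt (∑ b, f'' b ^ 2))) := by rw [e]; ring
          _ = _ := by ring

/-- **THE PLAIN LOCAL PAIRING BETWEEN TWO FIELDS** (`w ≡ 1`, `ρ = 0`): `‖⟪toL2 X′, toL2(η⁻²(Δ′₁ − 𝒦)X″)⟫‖ ≤ 32√2·ε₀·(d·6^d)·‖toL2 X′‖·‖toL2 X″‖`.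
[cite: Balaban1985Variational, (134)–(136) p.298; Balaban1985BackgroundPropagators, (3.10) p.392] -/
theorem norm_inner_local_le₂ {ε₀ : ℝ} (hε₀ : 0 ≤ ε₀) (hreg : RegPr F n K ε₀ U₀) (X' X'' : PBond (F.P K) 0 → Matrix (Fin 2) (Fin 2) ℂ) :
    ‖⟪toL2 F K c₀ X', toL2 F K c₀ (fun b : PBond (F.P K) 0 => (eta F n K)⁻¹ • (eta F n K)⁻¹ •
        (deltaPrimeOp (torusT (F.P K) 0) (fun μ x => bgUnits F K U₀ ⟨x, μ⟩) 1 (formComp X'') b.dir b.src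
          - curvOp (torusT (F.P K) 0) (fun μ x => bgUnits F K U₀ ⟨x, μ⟩) (formComp X'') b.dir b.src))⟫_ℂ‖
      ≤ 32 * Real.sqrt 2 * ε₀ * (((F.P K).d : ℝ) * (2 * 3) ^ (F.P K).d) * ‖toL2 F K c₀ X'‖ * ‖toL2 F K c₀ X''‖ := by
  have h := norm_inner_local_conj_le₂ F c₀ U₀ hε₀ hreg (fun _ => (1 : ℝ)) (fun _ => zero_lt_one) (ρ := 0)
    (fun b => ⟨by simp, by simp⟩) X' X''
  have e1 : (fun b : PBond (F.P K) 0 => (1 : ℝ) • X' b) = X' := funext fun b => one_smul _ _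
  have e2 : (fun b' : PBond (F.P K) 0 => ((1 : ℝ))⁻¹ • X'' b') = X'' := funext fun b => by rw [inv_one, one_smul]
  rw [e1, e2] at h
  simpa using h

end L

/-! ## §5 ★★★ The bilinear conjugation defect of `V = Δ_a − D†D` from the four pieces -/

section Export

/-- **COMPLEX BOOKKEEPING**: if `Φ₁ = K₁ + L₁ + S₁ − P₁ + a·Q₁`, `Φ₀ = K₀ + L₀ + S₀ − P₀ + a·Q₀` (`0 ≤ a`) with `‖L₁‖ ≤ b_{L1}`, `‖L₀‖ ≤ b_{L0}`, `‖S₁ − S₀‖ ≤ b_S`, `‖P₁ − P₀‖ ≤ b_P`,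
`‖Q₁ − Q₀‖ ≤ b_Q`, then `|re((Φ₁ − K₁) − (Φ₀ − K₀))| ≤ b_{L1} + b_{L0} + b_S + b_P + a·b_Q`. [folklore] -/
theorem abs_re_sub_le_of_pieces {Φ₁ K₁ L₁ S₁ P₁ Q₁ Φ₀ K₀ L₀ S₀ P₀ Q₀ : ℂ} {a bL₁ bL₀ bS bP bQ : ℝ} (ha : 0 ≤ a)
    (h₁ : Φ₁ = K₁ + L₁ + S₁ - P₁ + ((a : ℝ) : ℂ) * Q₁) (h₀ : Φ₀ = K₀ + L₀ + S₀ - P₀ + ((a : ℝ) : ℂ) * Q₀)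
    (hL₁ : ‖L₁‖ ≤ bL₁) (hL₀ : ‖L₀‖ ≤ bL₀) (hS : ‖S₁ - S₀‖ ≤ bS) (hP : ‖P₁ - P₀‖ ≤ bP) (hQ : ‖Q₁ - Q₀‖ ≤ bQ) :
    |RCLike.re ((Φ₁ - K₁) - (Φ₀ - K₀))| ≤ bL₁ + bL₀ + bS + bP + a * bQ := by
  have hid : (Φ₁ - K₁) - (Φ₀ - K₀) = L₁ + (-L₀) + (S₁ - S₀) + (-(P₁ - P₀)) + ((a : ℝ) : ℂ) * (Q₁ - Q₀) := by
    rw [h₁, h₀]; ring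
  rw [hid]
  refine (RCLike.abs_re_le_norm _).trans ?_
  have hQ' : ‖((a : ℝ) : ℂ) * (Q₁ - Q₀)‖ ≤ a * bQ := by
    rw [norm_mul, Complex.norm_real, Real.norm_of_nonneg ha]; exact mul_le_mul_of_nonneg_left hQ ha
  have hL₀' : ‖-L₀‖ ≤ bL₀ := by rw [norm_neg]; exact hL₀
  have hP' : ‖-(P₁ - P₀)‖ ≤ bP := by rw [norm_neg]; exact hP
  have e1 : ‖L₁ + -L₀‖ ≤ bL₁ + bL₀ := (norm_add_le _ _).trans (add_le_add hL₁ hL₀')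
  have e2 : ‖L₁ + -L₀ + (S₁ - S₀)‖ ≤ bL₁ + bL₀ + bS := (norm_add_le _ _).trans (add_le_add e1 hS)
  have e3 : ‖L₁ + -L₀ + (S₁ - S₀) + -(P₁ - P₀)‖ ≤ bL₁ + bL₀ + bS + bP := (norm_add_le _ _).trans (add_le_add e2 hP')
  exact (norm_add_le _ _).trans (add_le_add e3 hQ')

variable (F : T3Family) {n K : ℕ} (h : n ≤ K) (c₀ cB : ℝ) [Fact (0 < c₀)] [Fact (0 < cB)] {a : ℝ}
  {Δx : GaugeField (F.P K) 0 (Matrix.specialUnitaryGroup (Fin 2) ℂ) → (BondL2K ℂ 3 (periodsT3 F K) c₀ W₂ →ₗ[ℂ] BondL2K ℂ 3 (periodsT3 F K) c₀ W₂)}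

/-- ★★★ **THE BILINEAR CONJUGATION DEFECT OF `V := Δ_a − D†D` AT THE MEMBER, FROM THE LETTERS** (the `hVconj₂` of (K2b-δ₃)-A ✓∕⧗`Prop7OneFormConjugateResolvent.norm_conj_resolvent_sub_le`).
`RegPr F n K ε₀ U₀` + routeR-w4's windows, `0 ≤ a`; a positive site weight with A3's bond ratios `hρ`∕`hρ′`, the (Q) read-set ratios `hρQ` and the (P) far ratios `hwfar` (`ν < μ′`); the letters
`hk` (the EX row `h349`'s kernel text, `Ck`, `μ′`), `hQ` (`C_Q`), and the BILINEAR slot letter `hslot₂` (`θ_S`; `= 0` at `DeltaEtaSlot`, below).  THEN for all bond fields `X′`, `X″`: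
`|re([⟪toL2(w(b₋)·X′), Δ_a(toL2(w(b₋)⁻¹·X″))⟫ − Σ_μ⟪D(toL2S (w·X′)_μ), D(toL2S (w⁻¹·X″)_μ)⟫] − [⟪toL2 X′, Δ_a(toL2 X″)⟫ − Σ_μ⟪D(toL2S X′_μ), D(toL2S X″_μ)⟫])| ≤ θ₂·‖toL2 X′‖·‖toL2 X″‖`,
**`θ₂ = a·(2√κ²·C_Q + κ²) + √2·Ck·θc·(d(L^d)^{K−n}(2(1+1∕(μ′−ν)))³) + θ_S + 32√2·ε₀·d·6^d·(1 + (1+ρ)²)`** (`κ² = 216ρ_Q²(cB∕(c₀ℓ³))` — the SAME constant as A2c's diagonal `θ_V`).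
[cite: Balaban1985BackgroundPropagators, (3.26) p.395, Thm 3.1 (3.46) p.398, (3.49) p.399, (3.132) p.422; Balaban1985Variational, (134)–(136) p.298; Agmon1982, Ch. 1] -/
theorem hVconj₂_of_letters {ε₀ : ℝ} (hε₀ : 0 < ε₀) (hε : 10 ^ 10 * (F.L : ℝ) ^ 6 * ε₀ ≤ 1) (hε12 : 10 ^ 12 * (F.L : ℝ) ^ 3 * ε₀ ≤ 1)
    (U₀ : GaugeField (F.P K) 0 (Matrix.specialUnitaryGroup (Fin 2) ℂ)) (hreg : RegPr F n K ε₀ U₀) (ha : 0 ≤ a)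
    (w : Site (F.P K) 0 → ℝ) (hw : ∀ x, 0 < w x) {ρ : ℝ}
    (hρ : ∀ b : PBond (F.P K) 0, |w b.tgt / w b.src - 1| ≤ ρ) (hρ' : ∀ b : PBond (F.P K) 0, |w b.src / w b.tgt - 1| ≤ ρ)
    (xr : PBond (F.P n) 0 → Site (F.P K) 0) {ρQ : ℝ}
    (hρQ : ∀ (c : PBond (F.P n) 0) (b : PBond (F.P K) 0),
      (iterBlockOf (K - n) b.src = (bondShift (sites_eq F n K h) c).src ∨ iterBlockOf (K - n) b.src = (bondShift (sites_eq F n K h) c).tgt) →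
      |w b.src / w (xr c) - 1| ≤ ρQ ∧ |w (xr c) / w b.src - 1| ≤ ρQ)
    {θc ν μ' Ck : ℝ} (hθc : 0 ≤ θc) (hCk : 0 ≤ Ck) (hνμ : ν < μ')
    (hwfar : ∀ x x' : Site (F.P K) 0, |w x / w x' - 1| ≤ θc * Real.exp (ν * (Site.tdist (P := F.P K) (iterBlockOf (K - n) x) (iterBlockOf (K - n) x') : ℝ)))
    (hk : ∀ (b : PBond (F.P K) 0) (Z : Matrix (Fin 2) (Fin 2) ℂ) (bd : PBond (F.P K) 0),
      ‖(toL2 F K c₀).symm (DL2 F n K c₀ U₀ (DstarL2 F n K c₀ U₀ (toL2 F K c₀ (Pi.single b Z)) - RS F n K h c₀ cB U₀ (DstarL2 F n K c₀ U₀ (toL2 F K c₀ (Pi.single b Z))))) bd‖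
        ≤ Ck * Real.exp (-(μ' * (Site.tdist (P := F.P K) (iterBlockOf (K - n) b.src) (iterBlockOf (K - n) bd.src) : ℝ))) * ‖Z‖)
    {CQ : ℝ} (hQ : ∀ v : BondL2K ℂ 3 (periodsT3 F K) c₀ W₂, ‖Qk F n K h c₀ cB U₀ v‖ ≤ CQ * ‖v‖)
    {θS : ℝ} (hslot₂ : ∀ X' X'' : PBond (F.P K) 0 → Matrix (Fin 2) (Fin 2) ℂ,
      ‖⟪toL2 F K c₀ (fun b => w b.src • X' b),
          (Δx U₀ - (DeltaEta F n K c₀ U₀ : BondL2K ℂ 3 (periodsT3 F K) c₀ W₂ →ₗ[ℂ] BondL2K ℂ 3 (periodsT3 F K) c₀ W₂)) (toL2 F K c₀ (fun b => (w b.src)⁻¹ • X'' b))⟫_ℂ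
        - ⟪toL2 F K c₀ X', (Δx U₀ - (DeltaEta F n K c₀ U₀ : BondL2K ℂ 3 (periodsT3 F K) c₀ W₂ →ₗ[ℂ] BondL2K ℂ 3 (periodsT3 F K) c₀ W₂)) (toL2 F K c₀ X'')⟫_ℂ‖
        ≤ θS * ‖toL2 F K c₀ X'‖ * ‖toL2 F K c₀ X''‖) :
    ∀ X' X'' : PBond (F.P K) 0 → Matrix (Fin 2) (Fin 2) ℂ,
      |RCLike.re ((⟪toL2 F K c₀ (fun b => w b.src • X' b), laplaceA F n K h c₀ cB a Δx U₀ (toL2 F K c₀ (fun b => (w b.src)⁻¹ • X'' b))⟫_ℂ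
            - ∑ μ : Fin (F.P K).d, ⟪DL2 F n K c₀ U₀ (toL2S F K c₀ (formComp (fun b => w b.src • X' b) μ)),
                DL2 F n K c₀ U₀ (toL2S F K c₀ (formComp (fun b => (w b.src)⁻¹ • X'' b) μ))⟫_ℂ)
          - (⟪toL2 F K c₀ X', laplaceA F n K h c₀ cB a Δx U₀ (toL2 F K c₀ X'')⟫_ℂ
            - ∑ μ : Fin (F.P K).d, ⟪DL2 F n K c₀ U₀ (toL2S F K c₀ (formComp X' μ)), DL2 F n K c₀ U₀ (toL2S F K c₀ (formComp X'' μ))⟫_ℂ))|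
        ≤ (a * (2 * Real.sqrt (216 * ρQ ^ 2 * (cB / (c₀ * ((F.L : ℝ) ^ (K - n)) ^ 3))) * CQ + 216 * ρQ ^ 2 * (cB / (c₀ * ((F.L : ℝ) ^ (K - n)) ^ 3)))
            + Real.sqrt 2 * Ck * θc * (((F.P K).d : ℝ) * ((((F.P K).L : ℝ) ^ (F.P K).d) ^ (K - n)) * (2 * (1 + 1 / (μ' - ν))) ^ 3)
            + θS + 32 * Real.sqrt 2 * ε₀ * (((F.P K).d : ℝ) * (2 * 3) ^ (F.P K).d) * (1 + (1 + ρ) ^ 2))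
          * ‖toL2 F K c₀ X'‖ * ‖toL2 F K c₀ X''‖ := by
  intro X' X''
  -- the operator `B := D(1 − R_S)D*` and its displayed kernel row
  set B : BondL2K ℂ 3 (periodsT3 F K) c₀ W₂ →ₗ[ℂ] BondL2K ℂ 3 (periodsT3 F K) c₀ W₂ :=
    DL2 F n K c₀ U₀ ∘ₗ (LinearMap.id - RS F n K h c₀ cB U₀) ∘ₗ DstarL2 F n K c₀ U₀ with hB
  have hBv : ∀ v, B v = DL2 F n K c₀ U₀ (DstarL2 F n K c₀ U₀ v - RS F n K h c₀ cB U₀ (DstarL2 F n K c₀ U₀ v)) := fun v => by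
    simp only [hB, LinearMap.comp_apply, LinearMap.sub_apply, LinearMap.id_apply]
  have hkB : ∀ (b : PBond (F.P K) 0) (Z : Matrix (Fin 2) (Fin 2) ℂ) (bd : PBond (F.P K) 0),
      ‖(toL2 F K c₀).symm (B (toL2 F K c₀ (Pi.single b Z))) bd‖
        ≤ Ck * Real.exp (-(μ' * (Site.tdist (P := F.P K) (iterBlockOf (K - n) b.src) (iterBlockOf (K - n) bd.src) : ℝ))) * ‖Z‖ := fun b Z bd => by
    rw [hBv]; exact hk b Z bd
  -- the four pieces, bilinear
  have hP := norm_inner_conj_kernel_sub_le₂ F B w hθc hCk hνμ hwfar hkB X' X''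
  rw [hBv, hBv] at hP
  have hQc := norm_inner_Qk_conj_sub_le₂ F h c₀ cB hε₀ hε hε12 U₀ hreg w hw xr hρQ X' X''
  have hL₁ := norm_inner_local_conj_le₂ F c₀ U₀ hε₀.le hreg w hw (fun b => ⟨hρ b, hρ' b⟩) X' X''
  have hL₀ := norm_inner_local_le₂ F c₀ U₀ hε₀.le hreg X' X''
  have hS := hslot₂ X' X''
  -- the two form identities
  have hmix := inner_laplaceA_eq₂ (h := h) (cB := cB) (a := a) (Δx := Δx) U₀ (fun b => w b.src • X' b) (fun b => (w b.src)⁻¹ • X'' b)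
  have hdiag := inner_laplaceA_eq₂ (h := h) (cB := cB) (a := a) (Δx := Δx) U₀ X' X''
  -- the (Q) piece against the operator bound
  set κ2 : ℝ := 216 * ρQ ^ 2 * (cB / (c₀ * ((F.L : ℝ) ^ (K - n)) ^ 3)) with hκ2
  have hκ0 : 0 ≤ Real.sqrt κ2 := Real.sqrt_nonneg _
  have hX'0 : 0 ≤ ‖toL2 F K c₀ X'‖ := norm_nonneg _
  have hX''0 : 0 ≤ ‖toL2 F K c₀ X''‖ := norm_nonneg _
  have hQ2 : Real.sqrt κ2 * (‖Qk F n K h c₀ cB U₀ (toL2 F K c₀ X')‖ * ‖toL2 F K c₀ X''‖ + ‖toL2 F K c₀ X'‖ * ‖Qk F n K h c₀ cB U₀ (toL2 F K c₀ X'')‖)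
        + κ2 * ‖toL2 F K c₀ X'‖ * ‖toL2 F K c₀ X''‖ ≤ (2 * Real.sqrt κ2 * CQ + κ2) * ‖toL2 F K c₀ X'‖ * ‖toL2 F K c₀ X''‖ := by
    have t1 : ‖Qk F n K h c₀ cB U₀ (toL2 F K c₀ X')‖ * ‖toL2 F K c₀ X''‖ ≤ CQ * ‖toL2 F K c₀ X'‖ * ‖toL2 F K c₀ X''‖ :=
      mul_le_mul_of_nonneg_right (hQ _) hX''0
    have t2 : ‖toL2 F K c₀ X'‖ * ‖Qk F n K h c₀ cB U₀ (toL2 F K c₀ X'')‖ ≤ ‖toL2 F K c₀ X'‖ * (CQ * ‖toL2 F K c₀ X''‖) :=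
      mul_le_mul_of_nonneg_left (hQ _) hX'0
    have t3 := mul_le_mul_of_nonneg_left (add_le_add t1 t2) hκ0
    calc _ ≤ Real.sqrt κ2 * (CQ * ‖toL2 F K c₀ X'‖ * ‖toL2 F K c₀ X''‖ + ‖toL2 F K c₀ X'‖ * (CQ * ‖toL2 F K c₀ X''‖)) + κ2 * ‖toL2 F K c₀ X'‖ * ‖toL2 F K c₀ X''‖ :=
          add_le_add t3 le_rfl
      _ = (2 * Real.sqrt κ2 * CQ + κ2) * ‖toL2 F K c₀ X'‖ * ‖toL2 F K c₀ X''‖ := by ring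
  have hmain := abs_re_sub_le_of_pieces ha hmix hdiag hL₁ hL₀ hS hP (hQc.trans hQ2)
  refine hmain.trans (le_of_eq ?_)
  rw [hκ2]
  ring

omit [Fact (0 < cB)] in
/-- At the slot of record `Δx := DeltaEtaSlot` the slot operator `Δx U₀ − Δ^η` vanishes (`rfl`), so the bilinear slot letter holds with `θ_S = 0`.
[cite: Balaban1985BackgroundPropagators, (3.26)–(3.27) p.395, p.421] -/
theorem hslot₂_DeltaEtaSlot (U₀ : GaugeField (F.P K) 0 (Matrix.specialUnitaryGroup (Fin 2) ℂ)) (w : Site (F.P K) 0 → ℝ) :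
    ∀ X' X'' : PBond (F.P K) 0 → Matrix (Fin 2) (Fin 2) ℂ,
      ‖⟪toL2 F K c₀ (fun b => w b.src • X' b),
          (DeltaEtaSlot F n K c₀ U₀ - (DeltaEta F n K c₀ U₀ : BondL2K ℂ 3 (periodsT3 F K) c₀ W₂ →ₗ[ℂ] BondL2K ℂ 3 (periodsT3 F K) c₀ W₂)) (toL2 F K c₀ (fun b => (w b.src)⁻¹ • X'' b))⟫_ℂ
        - ⟪toL2 F K c₀ X', (DeltaEtaSlot F n K c₀ U₀ - (DeltaEta F n K c₀ U₀ : BondL2K ℂ 3 (periodsT3 F K) c₀ W₂ →ₗ[ℂ] BondL2K ℂ 3 (periodsT3 F K) c₀ W₂)) (toL2 F K c₀ X'')⟫_ℂ‖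
        ≤ 0 * ‖toL2 F K c₀ X'‖ * ‖toL2 F K c₀ X''‖ := by
  intro X' X''
  have h0 : DeltaEtaSlot F n K c₀ U₀ - (DeltaEta F n K c₀ U₀ : BondL2K ℂ 3 (periodsT3 F K) c₀ W₂ →ₗ[ℂ] BondL2K ℂ 3 (periodsT3 F K) c₀ W₂) = 0 := by
    rw [sub_eq_zero]; rfl
  simp only [h0, LinearMap.zero_apply, inner_zero_right, sub_zero, norm_zero, zero_mul, le_refl]

/-- ★★★ **THE BILINEAR LETTER AT THE SLOT OF RECORD `Δx := DeltaEtaSlot`** (§5 with `θ_S = 0`): `θ₂ = a·(2√κ²·C_Q + κ²) + √2·Ck·θc·(d(L^d)^{K−n}(2(1+1∕(μ′−ν)))³) + 32√2·ε₀·d·6^d·(1 + (1+ρ)²)`.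
[cite: Balaban1985BackgroundPropagators, (3.26) p.395, Thm 3.1 (3.46) p.398, (3.49) p.399, (3.132) p.422; Balaban1985Variational, (134)–(136) p.298; Agmon1982, Ch. 1] -/
theorem hVconj₂_of_letters_DeltaEtaSlot {ε₀ : ℝ} (hε₀ : 0 < ε₀) (hε : 10 ^ 10 * (F.L : ℝ) ^ 6 * ε₀ ≤ 1) (hε12 : 10 ^ 12 * (F.L : ℝ) ^ 3 * ε₀ ≤ 1)
    (U₀ : GaugeField (F.P K) 0 (Matrix.specialUnitaryGroup (Fin 2) ℂ)) (hreg : RegPr F n K ε₀ U₀) (ha : 0 ≤ a)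
    (w : Site (F.P K) 0 → ℝ) (hw : ∀ x, 0 < w x) {ρ : ℝ}
    (hρ : ∀ b : PBond (F.P K) 0, |w b.tgt / w b.src - 1| ≤ ρ) (hρ' : ∀ b : PBond (F.P K) 0, |w b.src / w b.tgt - 1| ≤ ρ)
    (xr : PBond (F.P n) 0 → Site (F.P K) 0) {ρQ : ℝ}
    (hρQ : ∀ (c : PBond (F.P n) 0) (b : PBond (F.P K) 0),
      (iterBlockOf (K - n) b.src = (bondShift (sites_eq F n K h) c).src ∨ iterBlockOf (K - n) b.src = (bondShift (sites_eq F n K h) c).tgt) →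
      |w b.src / w (xr c) - 1| ≤ ρQ ∧ |w (xr c) / w b.src - 1| ≤ ρQ)
    {θc ν μ' Ck : ℝ} (hθc : 0 ≤ θc) (hCk : 0 ≤ Ck) (hνμ : ν < μ')
    (hwfar : ∀ x x' : Site (F.P K) 0, |w x / w x' - 1| ≤ θc * Real.exp (ν * (Site.tdist (P := F.P K) (iterBlockOf (K - n) x) (iterBlockOf (K - n) x') : ℝ)))
    (hk : ∀ (b : PBond (F.P K) 0) (Z : Matrix (Fin 2) (Fin 2) ℂ) (bd : PBond (F.P K) 0),
      ‖(toL2 F K c₀).symm (DL2 F n K c₀ U₀ (DstarL2 F n K c₀ U₀ (toL2 F K c₀ (Pi.single b Z)) - RS F n K h c₀ cB U₀ (DstarL2 F n K c₀ U₀ (toL2 F K c₀ (Pi.single b Z))))) bd‖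
        ≤ Ck * Real.exp (-(μ' * (Site.tdist (P := F.P K) (iterBlockOf (K - n) b.src) (iterBlockOf (K - n) bd.src) : ℝ))) * ‖Z‖)
    {CQ : ℝ} (hQ : ∀ v : BondL2K ℂ 3 (periodsT3 F K) c₀ W₂, ‖Qk F n K h c₀ cB U₀ v‖ ≤ CQ * ‖v‖) :
    ∀ X' X'' : PBond (F.P K) 0 → Matrix (Fin 2) (Fin 2) ℂ,
      |RCLike.re ((⟪toL2 F K c₀ (fun b => w b.src • X' b), laplaceA F n K h c₀ cB a (DeltaEtaSlot F n K c₀) U₀ (toL2 F K c₀ (fun b => (w b.src)⁻¹ • X'' b))⟫_ℂ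
            - ∑ μ : Fin (F.P K).d, ⟪DL2 F n K c₀ U₀ (toL2S F K c₀ (formComp (fun b => w b.src • X' b) μ)),
                DL2 F n K c₀ U₀ (toL2S F K c₀ (formComp (fun b => (w b.src)⁻¹ • X'' b) μ))⟫_ℂ)
          - (⟪toL2 F K c₀ X', laplaceA F n K h c₀ cB a (DeltaEtaSlot F n K c₀) U₀ (toL2 F K c₀ X'')⟫_ℂ
            - ∑ μ : Fin (F.P K).d, ⟪DL2 F n K c₀ U₀ (toL2S F K c₀ (formComp X' μ)), DL2 F n K c₀ U₀ (toL2S F K c₀ (formComp X'' μ))⟫_ℂ))|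
        ≤ (a * (2 * Real.sqrt (216 * ρQ ^ 2 * (cB / (c₀ * ((F.L : ℝ) ^ (K - n)) ^ 3))) * CQ + 216 * ρQ ^ 2 * (cB / (c₀ * ((F.L : ℝ) ^ (K - n)) ^ 3)))
            + Real.sqrt 2 * Ck * θc * (((F.P K).d : ℝ) * ((((F.P K).L : ℝ) ^ (F.P K).d) ^ (K - n)) * (2 * (1 + 1 / (μ' - ν))) ^ 3)
            + 32 * Real.sqrt 2 * ε₀ * (((F.P K).d : ℝ) * (2 * 3) ^ (F.P K).d) * (1 + (1 + ρ) ^ 2))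
          * ‖toL2 F K c₀ X'‖ * ‖toL2 F K c₀ X''‖ := by
  intro X' X''
  have hmain := hVconj₂_of_letters F h c₀ cB (a := a) (Δx := DeltaEtaSlot F n K c₀) hε₀ hε hε12 U₀ hreg ha w hw hρ hρ' xr hρQ hθc hCk hνμ hwfar hk hQ
    (θS := 0) (hslot₂_DeltaEtaSlot F c₀ U₀ w) X' X''
  rw [add_zero] at hmain
  exact hmain

end Export

end Summit.QuantumFields.YangMills.Theorems.Prop7OneFormAgmonBilinearExport

end
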